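import Mathlib.Analysis.SpecialFunctions.Integrability.Basic
import Literature.Analysis.FluidPDE.PressureNormalisationLq
import Literature.Analysis.FluidPDE.ClassicalLocalEnergyCutoff
import Literature.Analysis.FluidPDE.ClassicalL3Mild
import Literature.Analysis.FluidPDE.SuitableWeak
import HarnessLib

/-!
# Local energy classes up to the top time for classical `L^q` solutions with a subcritical rate

Analysis/FluidPDE proofs file (theorems only; no definitions, no named facts) on the discharge
path of the named fact `Literature.Analysis.FluidPDE.chaeWolf2017_dss_typeI_decay`
(`ChaeWolfRemovingDSS.lean`; D. Chae, J. Wolf, arXiv:1610.09464, Thm. 1.1). It renders **Step 2**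
of the printed proof ("Local energy inequality", arXiv p. 5: the bound (2.4c)
`‖u‖²_{L^∞(−R²,0;L²(B(0,R)))} + ‖∇u‖²_{2,Q(0,R)} < ∞` obtained from the local energy equality
(2.4f) and the time asymptotics (2.4a) `‖u(t)‖_p ≲ (−t)^{(3−p)/(2p)}`, (2.4b)
`‖π(t)‖_{p/2} ≲ ‖u(t)‖_p²`) in the range where the three terms `I, II, III` of (2.4f) are finite
*without* absorption, namely under a blow-up rate `‖u(t)‖_{L^q} ≤ K₀ (−t)^{−κ}` with `3κ < 1`
(for Chae–Wolf's `λ`-DSS solutions `κ = (q−3)/(2q)`, so this is the range `3 ≤ q < 9`).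

For a classical solution `(u, p)` of the unforced Navier–Stokes system (`ν = 1`) on
`ℝ³ × (−∞, 0)` with `u(t) ∈ L^q`, `3 ≤ q`, and `‖u(t)‖_{L^q} ≤ K₀(−t)^{−κ}` on `(−T, 0)`, `3κ < 1`:

* `IsClassicalNSSolutionOn.exists_rieszPressure_slice_of_rate` — the slice pressures: for every
  `t ∈ (−T, 0)` some `Q ∈ L^{q/2}` with `‖Q‖_{q/2} ≤ C_q ‖u(t)‖_q²`, `ΔQ = −∂ᵢ∂ⱼ(uᵢuⱼ)` weakly and
  `p(t) = Q + C(t)` a.e. ((2.4b) plus the normalisation `PressureNormalisationLq`);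
* `abs_flux_cutoff_le` — the slice bound of the right-hand side of (2.4f) against a cut-off `φ`
  supported in `B̄(x₀, R)`:
  `|∫ (Δφ|u|² + Dφ(u)|u|² + 2pDφ(u))| ≤ a₁ ‖u‖_q² + a₂ ‖u‖_q³` (Hölder on the ball in `L^q`,
  `L^{q/2}`; the pressure term through `p = Q + C`, `∫ Dφ(u) = 0` and Young's inequality
  `|Q||u| ≤ ⅔|Q|^{3/2} + ⅓|u|³`);
* `IsClassicalNSSolutionOn.exists_energy_classes_of_rate` — **(2.4c) at every cylinder
  `Q_ρ(0, x₀)` with `ρ² < T`**: `sup_{−ρ²<t<0} ∫_{B(x₀,ρ)} |u(t)|² < ∞` and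
  `∫∫_{Q_ρ(0,x₀)} |∇u|² < ∞` (the integrated local energy identity
  `IsClassicalNSSolutionOn.local_energy_identity_cutoff` on `[t₀, t]`, `t ↑ 0`, with the
  integrable majorant `a₁K₀²(−s)^{−2κ} + a₂K₀³(−s)^{−3κ} ≤ (a₁K₀² + a₂K₀³)(1 + (−s)^{−3κ})`).

## References

* D. Chae, J. Wolf, arXiv:1610.09464, §2 Step 2, (2.4a)–(2.4c), (2.4f) (p. 5–6).
  [ChaeWolf2017RemovingDSS]
-/

noncomputable section

open MeasureTheory TopologicalSpace Set Function Filter Metric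
open _root_.Topology
open scoped Laplacian InnerProductSpace RealInnerProductSpace ENNReal NNReal ContDiff

namespace Literature.Analysis.FluidPDE

namespace ChaeWolfEnergy

open PressureNormalisation PressureNormalisationL3

/-! ### Hölder on balls for the three slice quantities -/

section Slice

variable {q : ℝ}

/-- `‖ ‖v‖³ ‖_{L^{q/3}} = ‖v‖_{L^q}³`, so `≤ M³` when `‖v‖_{L^q} ≤ M` (`q > 0`). [folklore] -/
theorem eLpNorm_norm_cube_le {F' : Type*} [NormedAddCommGroup F']
    {v : (EuclideanSpace ℝ (Fin 3)) → F'} (hq : 0 < q) {M : ℝ≥0}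
    (hM : eLpNorm v (ENNReal.ofReal q) volume ≤ M) :
    eLpNorm (fun y => ‖v y‖ ^ 3) (ENNReal.ofReal (q / 3)) volume ≤ ((M ^ 3 : ℝ≥0) : ℝ≥0∞) := by
  have e : eLpNorm (fun y => ‖v y‖ ^ (3 : ℝ)) (ENNReal.ofReal (q / 3)) volume =
      eLpNorm v (ENNReal.ofReal (q / 3) * ENNReal.ofReal 3) volume ^ (3 : ℝ) :=
    eLpNorm_norm_rpow v three_pos
  have e2 : ENNReal.ofReal (q / 3) * ENNReal.ofReal 3 = ENNReal.ofReal q := by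
    rw [← ENNReal.ofReal_mul (by linarith)]
    congr 1; ring
  have e3 : (fun y => ‖v y‖ ^ (3 : ℝ)) = fun y => ‖v y‖ ^ 3 := by
    funext y; exact_mod_cast Real.rpow_natCast ‖v y‖ 3
  rw [e2, e3] at e
  rw [e, ENNReal.coe_pow]
  have : eLpNorm v (ENNReal.ofReal q) volume ^ (3 : ℝ) = eLpNorm v (ENNReal.ofReal q) volume ^ 3 := by
    exact_mod_cast ENNReal.rpow_natCast _ 3
  rw [this]
  gcongr

/-- `|Q|^{3/2} ∈ L^{q/3}` with `‖ |Q|^{3/2} ‖_{L^{q/3}} = ‖Q‖_{L^{q/2}}^{3/2}` for `Q ∈ L^{q/2}`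
(`q > 0`). [folklore] -/
theorem memLp_abs_rpow_threeHalves {Q : (EuclideanSpace ℝ (Fin 3)) → ℝ} (hq : 0 < q)
    (hQ : MemLp Q (ENNReal.ofReal (q / 2)) volume) :
    MemLp (fun y => |Q y| ^ (3 / 2 : ℝ)) (ENNReal.ofReal (q / 3)) volume ∧
      eLpNorm (fun y => |Q y| ^ (3 / 2 : ℝ)) (ENNReal.ofReal (q / 3)) volume =
        eLpNorm Q (ENNReal.ofReal (q / 2)) volume ^ (3 / 2 : ℝ) := by
  have e : eLpNorm (fun y => ‖Q y‖ ^ (3 / 2 : ℝ)) (ENNReal.ofReal (q / 3)) volume =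
      eLpNorm Q (ENNReal.ofReal (q / 3) * ENNReal.ofReal (3 / 2)) volume ^ (3 / 2 : ℝ) :=
    eLpNorm_norm_rpow Q (by norm_num)
  have e2 : ENNReal.ofReal (q / 3) * ENNReal.ofReal (3 / 2) = ENNReal.ofReal (q / 2) := by
    rw [← ENNReal.ofReal_mul (by linarith)]
    congr 1; ring
  have e3 : (fun y => ‖Q y‖ ^ (3 / 2 : ℝ)) = fun y => |Q y| ^ (3 / 2 : ℝ) := by
    funext y; rw [Real.norm_eq_abs]
  rw [e2, e3] at e
  refine ⟨⟨?_, ?_⟩, e⟩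
  · have h1 : AEStronglyMeasurable (fun y => ‖Q y‖ ^ (3 / 2 : ℝ)) volume :=
      (Real.continuous_rpow_const (by norm_num : (0 : ℝ) ≤ 3 / 2)).comp_aestronglyMeasurable
        hQ.1.norm
    rwa [e3] at h1
  · rw [e]
    exact ENNReal.rpow_lt_top_of_nonneg (by norm_num) hQ.eLpNorm_ne_top

variable (x₀ : (EuclideanSpace ℝ (Fin 3))) (R : ℝ)

/-- **`∫_B ‖v‖² ≤ |B|^{1−2/q} M²`** for `‖v‖_{L^q} ≤ M`, `2 ≤ q`. [folklore] -/
theorem setIntegral_norm_sq_le {v : (EuclideanSpace ℝ (Fin 3)) → (EuclideanSpace ℝ (Fin 3))}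
    (hv : Continuous v) (hq : 2 ≤ q) {M : ℝ≥0} (hM : eLpNorm v (ENNReal.ofReal q) volume ≤ M) :
    ∫ y in closedBall x₀ R, ‖v y‖ ^ 2 ≤
      ((volume : Measure (EuclideanSpace ℝ (Fin 3))).real (closedBall x₀ R)) ^ (1 - 2 / q) *
        (M : ℝ) ^ 2 := by
  have hq0 : 0 < q := by linarith
  have hq1 : (1 : ℝ≥0∞) ≤ ENNReal.ofReal (q / 2) := by
    rw [← ENNReal.ofReal_one]; exact ENNReal.ofReal_le_ofReal (by linarith)
  have hsq := eLpNorm_norm_sq_le hq0 hM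
  have hmeas : AEStronglyMeasurable (fun y => ‖v y‖ ^ 2) volume :=
    (hv.norm.pow 2).aestronglyMeasurable
  have hB := setIntegral_norm_le_of_eLpNorm_le hmeas hq1 ENNReal.ofReal_ne_top hsq x₀ R
  rw [ENNReal.toReal_ofReal (by linarith), inv_div] at hB
  have e : ∫ y in closedBall x₀ R, ‖v y‖ ^ 2 = ∫ y in closedBall x₀ R, ‖‖v y‖ ^ 2‖ :=
    integral_congr_ae (Eventually.of_forall fun y => (Real.norm_of_nonneg (sq_nonneg _)).symm)
  rw [e]
  simpa using hB

/-- **`∫_B ‖v‖³ ≤ |B|^{1−3/q} M³`** for `‖v‖_{L^q} ≤ M`, `3 ≤ q`. [folklore] -/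
theorem setIntegral_norm_cube_le {v : (EuclideanSpace ℝ (Fin 3)) → (EuclideanSpace ℝ (Fin 3))}
    (hv : Continuous v) (hq : 3 ≤ q) {M : ℝ≥0} (hM : eLpNorm v (ENNReal.ofReal q) volume ≤ M) :
    ∫ y in closedBall x₀ R, ‖v y‖ ^ 3 ≤
      ((volume : Measure (EuclideanSpace ℝ (Fin 3))).real (closedBall x₀ R)) ^ (1 - 3 / q) *
        (M : ℝ) ^ 3 := by
  have hq0 : 0 < q := by linarith
  have hq1 : (1 : ℝ≥0∞) ≤ ENNReal.ofReal (q / 3) := by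
    rw [← ENNReal.ofReal_one]; exact ENNReal.ofReal_le_ofReal (by linarith)
  have hcube := eLpNorm_norm_cube_le hq0 hM
  have hmeas : AEStronglyMeasurable (fun y => ‖v y‖ ^ 3) volume :=
    (hv.norm.pow 3).aestronglyMeasurable
  have hB := setIntegral_norm_le_of_eLpNorm_le hmeas hq1 ENNReal.ofReal_ne_top hcube x₀ R
  rw [ENNReal.toReal_ofReal (by linarith), inv_div] at hB
  have e : ∫ y in closedBall x₀ R, ‖v y‖ ^ 3 = ∫ y in closedBall x₀ R, ‖‖v y‖ ^ 3‖ :=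
    integral_congr_ae (Eventually.of_forall fun y => (Real.norm_of_nonneg (by positivity)).symm)
  rw [e]
  simpa using hB

/-- **`∫_B |Q|^{3/2} ≤ |B|^{1−3/q} P^{3/2}`** and `|Q|^{3/2}` is integrable on `B`, for
`Q ∈ L^{q/2}` with `‖Q‖_{L^{q/2}} ≤ P`, `3 ≤ q`. [folklore] -/
theorem setIntegral_abs_rpow_threeHalves_le {Q : (EuclideanSpace ℝ (Fin 3)) → ℝ} (hq : 3 ≤ q)
    (hQ : MemLp Q (ENNReal.ofReal (q / 2)) volume) {P : ℝ≥0}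
    (hP : eLpNorm Q (ENNReal.ofReal (q / 2)) volume ≤ P) :
    IntegrableOn (fun y => |Q y| ^ (3 / 2 : ℝ)) (closedBall x₀ R) volume ∧
    ∫ y in closedBall x₀ R, |Q y| ^ (3 / 2 : ℝ) ≤
      ((volume : Measure (EuclideanSpace ℝ (Fin 3))).real (closedBall x₀ R)) ^ (1 - 3 / q) *
        (P : ℝ) ^ (3 / 2 : ℝ) := by
  have hq0 : 0 < q := by linarith
  have hq1 : (1 : ℝ≥0∞) ≤ ENNReal.ofReal (q / 3) := by
    rw [← ENNReal.ofReal_one]; exact ENNReal.ofReal_le_ofReal (by linarith)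
  obtain ⟨hmem, heq⟩ := memLp_abs_rpow_threeHalves hq0 hQ
  have hbound : eLpNorm (fun y => |Q y| ^ (3 / 2 : ℝ)) (ENNReal.ofReal (q / 3)) volume ≤
      ((P ^ (3 / 2 : ℝ) : ℝ≥0) : ℝ≥0∞) := by
    rw [heq, ENNReal.coe_rpow_of_nonneg _ (by norm_num)]
    exact ENNReal.rpow_le_rpow hP (by norm_num)
  have hB := setIntegral_norm_le_of_eLpNorm_le hmem.1 hq1 ENNReal.ofReal_ne_top hbound x₀ R
  rw [ENNReal.toReal_ofReal (by linarith), inv_div] at hB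
  refine ⟨(hmem.locallyIntegrable hq1).integrableOn_isCompact (isCompact_closedBall x₀ R), ?_⟩
  have e : ∫ y in closedBall x₀ R, |Q y| ^ (3 / 2 : ℝ) =
      ∫ y in closedBall x₀ R, ‖|Q y| ^ (3 / 2 : ℝ)‖ :=
    integral_congr_ae (Eventually.of_forall fun y => (Real.norm_of_nonneg (by positivity)).symm)
  rw [e]
  simpa [NNReal.coe_rpow] using hB

/-- **`∫_B |Q| ≤ |B|^{1−2/q} P`** for `Q ∈ L^{q/2}`, `‖Q‖_{L^{q/2}} ≤ P`, `2 ≤ q`. [folklore] -/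
theorem setIntegral_abs_le {Q : (EuclideanSpace ℝ (Fin 3)) → ℝ} (hq : 2 ≤ q)
    (hQ : MemLp Q (ENNReal.ofReal (q / 2)) volume) {P : ℝ≥0}
    (hP : eLpNorm Q (ENNReal.ofReal (q / 2)) volume ≤ P) :
    ∫ y in closedBall x₀ R, |Q y| ≤
      ((volume : Measure (EuclideanSpace ℝ (Fin 3))).real (closedBall x₀ R)) ^ (1 - 2 / q) *
        (P : ℝ) := by
  have hq1 : (1 : ℝ≥0∞) ≤ ENNReal.ofReal (q / 2) := by
    rw [← ENNReal.ofReal_one]; exact ENNReal.ofReal_le_ofReal (by linarith)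
  have hB := setIntegral_norm_le_of_eLpNorm_le hQ.1 hq1 ENNReal.ofReal_ne_top hP x₀ R
  rw [ENNReal.toReal_ofReal (by linarith), inv_div] at hB
  simpa [Real.norm_eq_abs] using hB

end Slice

/-! ### The slice bound of the flux -/

section Flux

variable {q : ℝ}

/-- Young's inequality `ab ≤ ⅔ a^{3/2} + ⅓ b³` for `a, b ≥ 0`. [folklore] -/
theorem young_threeHalves_three {a b : ℝ} (ha : 0 ≤ a) (hb : 0 ≤ b) :
    a * b ≤ 2 / 3 * a ^ (3 / 2 : ℝ) + 1 / 3 * b ^ 3 := by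
  have hpq : (3 / 2 : ℝ).HolderConjugate 3 := Real.holderConjugate_iff.2 ⟨by norm_num, by norm_num⟩
  have h := Real.young_inequality_of_nonneg ha hb hpq
  have e : b ^ (3 : ℝ) = b ^ 3 := by exact_mod_cast Real.rpow_natCast b 3
  rw [e] at h
  linarith

/-- **The slice bound of the right-hand side of the local energy identity.** Let `φ ∈ C_c^∞`
with `supp φ ⊆ B̄(x₀, R)`, `|Δφ| ≤ C_Δ`, `‖Dφ‖ ≤ C_D`; let `v ∈ C¹` be divergence free with
`‖v‖_{L^q} ≤ M`, `3 ≤ q`; let the (continuous) pressure slice satisfy `pr = Q + C` a.e. with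
`Q ∈ L^{q/2}`, `‖Q‖_{L^{q/2}} ≤ P`. Then, with `V = |B̄(x₀, R)|`,
`|∫ (νΔφ|v|² + Dφ(v)|v|² + 2 pr Dφ(v))| ≤ νC_Δ V^{1−2/q}M² + C_D V^{1−3/q}M³ + 2C_D(⅔V^{1−3/q}P^{3/2} + ⅓V^{1−3/q}M³)`
(Hölder on the ball; `∫ Dφ(v) = 0` removes the constant `C`; Young `|Q||v| ≤ ⅔|Q|^{3/2} + ⅓|v|³`) —
the bounds of `I, II, III` in Chae–Wolf 2017, Step 2, without absorption. [cite: ChaeWolf2017RemovingDSS, §2 Step 2 (arXiv p. 5–6)] -/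
theorem abs_flux_cutoff_le {φ : (EuclideanSpace ℝ (Fin 3)) → ℝ} {x₀ : (EuclideanSpace ℝ (Fin 3))}
    {R CΔ CD : ℝ} (hφ : ContDiff ℝ ∞ φ) (hφsupp : tsupport φ ⊆ closedBall x₀ R)
    (hΔ : ∀ x, |(Δ φ) x| ≤ CΔ) (hD : ∀ x, ‖fderiv ℝ φ x‖ ≤ CD) (hCΔ : 0 ≤ CΔ) (hCD : 0 ≤ CD)
    {v : (EuclideanSpace ℝ (Fin 3)) → (EuclideanSpace ℝ (Fin 3))} (hv : ContDiff ℝ 1 v)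
    (hdiv : VectorCalculus.IsDivFree v) (hq : 3 ≤ q)
    {M : ℝ≥0} (hvM : eLpNorm v (ENNReal.ofReal q) volume ≤ M)
    {pr : (EuclideanSpace ℝ (Fin 3)) → ℝ} (hpr : Continuous pr)
    {Q : (EuclideanSpace ℝ (Fin 3)) → ℝ} (hQ : MemLp Q (ENNReal.ofReal (q / 2)) volume)
    {P : ℝ≥0} (hQP : eLpNorm Q (ENNReal.ofReal (q / 2)) volume ≤ P) {C : ℝ}
    (hae : ∀ᵐ x ∂(volume : Measure (EuclideanSpace ℝ (Fin 3))), pr x = Q x + C)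
    {ν : ℝ} (hν : 0 ≤ ν) :
    |∫ x, (ν * ((Δ φ) x * ‖v x‖ ^ 2) + fderiv ℝ φ x (v x) * ‖v x‖ ^ 2 +
        2 * (pr x * fderiv ℝ φ x (v x)))| ≤
      ν * CΔ * (((volume : Measure (EuclideanSpace ℝ (Fin 3))).real (closedBall x₀ R)) ^ (1 - 2 / q) *
          (M : ℝ) ^ 2) +
        CD * (((volume : Measure (EuclideanSpace ℝ (Fin 3))).real (closedBall x₀ R)) ^ (1 - 3 / q) *
          (M : ℝ) ^ 3) +
        2 * CD * (2 / 3 * (((volume : Measure (EuclideanSpace ℝ (Fin 3))).real (closedBall x₀ R)) ^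
            (1 - 3 / q) * (P : ℝ) ^ (3 / 2 : ℝ)) +
          1 / 3 * (((volume : Measure (EuclideanSpace ℝ (Fin 3))).real (closedBall x₀ R)) ^
            (1 - 3 / q) * (M : ℝ) ^ 3)) := by
  set V : ℝ := (volume : Measure (EuclideanSpace ℝ (Fin 3))).real (closedBall x₀ R) with hV
  have hq2 : (2 : ℝ) ≤ q := by linarith
  have hq21 : (1 : ℝ≥0∞) ≤ ENNReal.ofReal (q / 2) := by
    rw [← ENNReal.ofReal_one]; exact ENNReal.ofReal_le_ofReal (by linarith)
  -- regularity of the cut-off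
  have hφc : HasCompactSupport φ :=
    IsCompact.of_isClosed_subset (isCompact_closedBall x₀ R) (isClosed_tsupport _) hφsupp
  have hφ1 : ContDiff ℝ 1 φ := hφ.of_le (by norm_cast)
  have hφ2 : ContDiff ℝ 2 φ := hφ.of_le (by norm_cast)
  have hΔc : Continuous (Δ φ) := FluidPDE.continuous_laplacian hφ2
  have hDc : Continuous (fderiv ℝ φ) := hφ1.continuous_fderiv one_ne_zero
  have hvc : Continuous v := hv.continuous
  have hout : ∀ y, R < dist y x₀ → y ∉ tsupport φ := fun y hy hmem => by
    have := hφsupp hmem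
    rw [mem_closedBall] at this
    linarith
  have hΔ0 : ∀ y, R < dist y x₀ → (Δ φ) y = 0 := fun y hy =>
    FluidPDE.laplacian_eq_zero_of_notMem_tsupport (hout y hy)
  have hD0 : ∀ y, R < dist y x₀ → fderiv ℝ φ y = 0 := fun y hy =>
    fderiv_of_notMem_tsupport ℝ (hout y hy)
  -- the three integrands
  set F₁ : (EuclideanSpace ℝ (Fin 3)) → ℝ := fun x => ν * ((Δ φ) x * ‖v x‖ ^ 2) with hF₁
  set F₂ : (EuclideanSpace ℝ (Fin 3)) → ℝ := fun x => fderiv ℝ φ x (v x) * ‖v x‖ ^ 2 with hF₂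
  set F₃ : (EuclideanSpace ℝ (Fin 3)) → ℝ := fun x => 2 * (pr x * fderiv ℝ φ x (v x)) with hF₃
  -- ## Term 1
  have hF₁m : AEStronglyMeasurable F₁ volume :=
    (continuous_const.mul (hΔc.mul (hvc.norm.pow 2))).aestronglyMeasurable
  have hF₁b : ∀ y, ‖F₁ y‖ ≤ ν * CΔ * ‖v y‖ ^ 2 := fun y => by
    show ‖ν * ((Δ φ) y * ‖v y‖ ^ 2)‖ ≤ _
    rw [norm_mul, norm_mul, Real.norm_of_nonneg hν, norm_pow, norm_norm, Real.norm_eq_abs]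
    calc ν * (|(Δ φ) y| * ‖v y‖ ^ 2) ≤ ν * (CΔ * ‖v y‖ ^ 2) := by gcongr; exact hΔ y
      _ = ν * CΔ * ‖v y‖ ^ 2 := by ring
  have hF₁0 : ∀ y, R < dist y x₀ → F₁ y = 0 := fun y hy => by simp [hF₁, hΔ0 y hy]
  obtain ⟨i1, b1⟩ := norm_integral_le_of_kernel_bound
    ((hvc.norm.pow 2).continuousOn.integrableOn_compact (isCompact_closedBall x₀ R)) hF₁m hF₁b hF₁0
  have B1 : |∫ x, F₁ x| ≤ ν * CΔ * (V ^ (1 - 2 / q) * (M : ℝ) ^ 2) := by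
    rw [← Real.norm_eq_abs]
    refine b1.trans (mul_le_mul_of_nonneg_left ?_ (by positivity))
    exact setIntegral_norm_sq_le x₀ R hvc hq2 hvM
  -- ## Term 2
  have hF₂m : AEStronglyMeasurable F₂ volume :=
    ((hDc.clm_apply hvc).mul (hvc.norm.pow 2)).aestronglyMeasurable
  have hF₂b : ∀ y, ‖F₂ y‖ ≤ CD * ‖v y‖ ^ 3 := fun y => by
    simp only [hF₂, norm_mul, norm_pow, norm_norm]
    calc ‖fderiv ℝ φ y (v y)‖ * ‖v y‖ ^ 2 ≤ (CD * ‖v y‖) * ‖v y‖ ^ 2 := by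
          gcongr
          exact (ContinuousLinearMap.le_opNorm _ _).trans (mul_le_mul_of_nonneg_right (hD y) (norm_nonneg _))
      _ = CD * ‖v y‖ ^ 3 := by ring
  have hF₂0 : ∀ y, R < dist y x₀ → F₂ y = 0 := fun y hy => by simp [hF₂, hD0 y hy]
  obtain ⟨i2, b2⟩ := norm_integral_le_of_kernel_bound
    ((hvc.norm.pow 3).continuousOn.integrableOn_compact (isCompact_closedBall x₀ R)) hF₂m hF₂b hF₂0
  have B2 : |∫ x, F₂ x| ≤ CD * (V ^ (1 - 3 / q) * (M : ℝ) ^ 3) := by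
    rw [← Real.norm_eq_abs]
    refine b2.trans (mul_le_mul_of_nonneg_left ?_ hCD)
    exact setIntegral_norm_cube_le x₀ R hvc hq hvM
  -- ## Term 3: remove the constant, then Young
  have hQloc : LocallyIntegrable Q volume := hQ.locallyIntegrable hq21
  have hDv : Continuous fun x => fderiv ℝ φ x (v x) := hDc.clm_apply hvc
  have hDvs : HasCompactSupport fun x => fderiv ℝ φ x (v x) := by
    refine HasCompactSupport.intro (isCompact_closedBall x₀ R) fun y hy => ?_
    have hy' : R < dist y x₀ := by rwa [mem_closedBall, not_le] at hy
    simp [hD0 y hy']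
  have iQD : Integrable (fun x => Q x * fderiv ℝ φ x (v x)) volume := by
    have hK : IsCompact (tsupport fun x => fderiv ℝ φ x (v x)) := hDvs
    have hon : IntegrableOn (fun x => Q x * fderiv ℝ φ x (v x)) (tsupport fun x => fderiv ℝ φ x (v x)) :=
      (hQloc.integrableOn_isCompact hK).mul_continuousOn hDv.continuousOn hK
    exact (integrableOn_iff_integrable_of_support_subset
      ((support_mul_subset_right _ _).trans (subset_tsupport _))).1 hon
  have iD : Integrable (fun x => fderiv ℝ φ x (v x)) volume := hDv.integrable_of_hasCompactSupport hDvs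
  have e3 : ∫ x, F₃ x = 2 * ∫ x, Q x * fderiv ℝ φ x (v x) := by
    have e1 : ∫ x, F₃ x = ∫ x, (2 * (Q x * fderiv ℝ φ x (v x)) + 2 * C * fderiv ℝ φ x (v x)) := by
      refine integral_congr_ae ?_
      filter_upwards [hae] with x hx
      simp only [hF₃, hx]
      ring
    rw [e1, integral_add (iQD.const_mul 2) (iD.const_mul _), integral_const_mul, integral_const_mul,
      integral_fderiv_apply_eq_zero_of_isDivFree hv hdiv hφ1 hφc, mul_zero, add_zero]
  -- kernel bound for `Q Dφ(v)`
  have hGm : AEStronglyMeasurable (fun x => Q x * fderiv ℝ φ x (v x)) volume := hQ.1.mul hDv.aestronglyMeasurable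
  have hGb : ∀ y, ‖Q y * fderiv ℝ φ y (v y)‖ ≤ CD * (|Q y| * ‖v y‖) := fun y => by
    rw [norm_mul, Real.norm_eq_abs]
    calc |Q y| * ‖fderiv ℝ φ y (v y)‖ ≤ |Q y| * (CD * ‖v y‖) := by
          gcongr
          exact (ContinuousLinearMap.le_opNorm _ _).trans (mul_le_mul_of_nonneg_right (hD y) (norm_nonneg _))
      _ = CD * (|Q y| * ‖v y‖) := by ring
  have hG0 : ∀ y, R < dist y x₀ → Q y * fderiv ℝ φ y (v y) = 0 := fun y hy => by simp [hD0 y hy]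
  have hHi : IntegrableOn (fun y => |Q y| * ‖v y‖) (closedBall x₀ R) volume := by
    have h1 : IntegrableOn (fun y => ‖Q y‖) (closedBall x₀ R) volume :=
      (hQloc.integrableOn_isCompact (isCompact_closedBall x₀ R)).norm
    exact (IntegrableOn.mul_continuousOn h1 hvc.norm.continuousOn (isCompact_closedBall x₀ R)).congr_fun
      (fun y _ => by simp [Real.norm_eq_abs]) measurableSet_closedBall
  obtain ⟨-, b3⟩ := norm_integral_le_of_kernel_bound hHi hGm hGb hG0
  -- Young and the two Hölder bounds
  obtain ⟨iQ32, bQ32⟩ := setIntegral_abs_rpow_threeHalves_le x₀ R hq hQ hQP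
  have iv3 : IntegrableOn (fun y => ‖v y‖ ^ 3) (closedBall x₀ R) volume :=
    (hvc.norm.pow 3).continuousOn.integrableOn_compact (isCompact_closedBall x₀ R)
  have hY : ∫ y in closedBall x₀ R, |Q y| * ‖v y‖ ≤
      2 / 3 * (V ^ (1 - 3 / q) * (P : ℝ) ^ (3 / 2 : ℝ)) + 1 / 3 * (V ^ (1 - 3 / q) * (M : ℝ) ^ 3) := by
    calc ∫ y in closedBall x₀ R, |Q y| * ‖v y‖
        ≤ ∫ y in closedBall x₀ R, (2 / 3 * |Q y| ^ (3 / 2 : ℝ) + 1 / 3 * ‖v y‖ ^ 3) :=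
          integral_mono_of_nonneg (Eventually.of_forall fun y => by positivity)
            ((iQ32.const_mul _).add (iv3.const_mul _))
            (Eventually.of_forall fun y => young_threeHalves_three (abs_nonneg _) (norm_nonneg _))
      _ = 2 / 3 * (∫ y in closedBall x₀ R, |Q y| ^ (3 / 2 : ℝ)) +
            1 / 3 * ∫ y in closedBall x₀ R, ‖v y‖ ^ 3 := by
          rw [integral_add (iQ32.const_mul _) (iv3.const_mul _), integral_const_mul, integral_const_mul]
      _ ≤ 2 / 3 * (V ^ (1 - 3 / q) * (P : ℝ) ^ (3 / 2 : ℝ)) + 1 / 3 * (V ^ (1 - 3 / q) * (M : ℝ) ^ 3) :=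
          add_le_add (mul_le_mul_of_nonneg_left bQ32 (by norm_num))
            (mul_le_mul_of_nonneg_left (setIntegral_norm_cube_le x₀ R hvc hq hvM) (by norm_num))
  have B3 : |∫ x, F₃ x| ≤ 2 * CD * (2 / 3 * (V ^ (1 - 3 / q) * (P : ℝ) ^ (3 / 2 : ℝ)) +
      1 / 3 * (V ^ (1 - 3 / q) * (M : ℝ) ^ 3)) := by
    rw [e3, abs_mul, abs_two]
    have : |∫ x, Q x * fderiv ℝ φ x (v x)| ≤ CD * (2 / 3 * (V ^ (1 - 3 / q) * (P : ℝ) ^ (3 / 2 : ℝ)) +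
        1 / 3 * (V ^ (1 - 3 / q) * (M : ℝ) ^ 3)) := by
      rw [← Real.norm_eq_abs]
      exact b3.trans (mul_le_mul_of_nonneg_left hY hCD)
    nlinarith
  -- ## assembly
  have i3 : Integrable F₃ volume := by
    have : Integrable (fun x => 2 * (pr x * fderiv ℝ φ x (v x))) volume :=
      ((hpr.mul hDv).integrable_of_hasCompactSupport hDvs.mul_left).const_mul 2
    exact this
  have efold : ∫ x, (ν * ((Δ φ) x * ‖v x‖ ^ 2) + fderiv ℝ φ x (v x) * ‖v x‖ ^ 2 +
      2 * (pr x * fderiv ℝ φ x (v x))) = ∫ x, (F₁ x + F₂ x + F₃ x) := by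
    simp only [hF₁, hF₂, hF₃]
  have h12 : Integrable (fun x => F₁ x + F₂ x) volume := i1.add i2
  rw [efold, integral_add h12 i3, integral_add i1 i2]
  calc |(∫ x, F₁ x) + (∫ x, F₂ x) + ∫ x, F₃ x| ≤ |∫ x, F₁ x| + |∫ x, F₂ x| + |∫ x, F₃ x| := abs_add_three _ _ _
    _ ≤ _ := add_le_add_three B1 B2 B3

end Flux

/-! ### Elementary real-variable facts on the majorant -/

section Real

/-- Powers of the rate: `(K y^{−κ})² = K² y^{−2κ}`, `(K y^{−κ})³ = K³ y^{−3κ}`,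
`(C (K y^{−κ})²)^{3/2} = C^{3/2} K³ y^{−3κ}` (`y > 0`, `K, C ≥ 0`). [folklore] -/
theorem rate_pow_identities {K C κ y : ℝ} (hK : 0 ≤ K) (hC : 0 ≤ C) (hy : 0 < y) :
    (K * y ^ (-κ)) ^ 2 = K ^ 2 * y ^ (-(2 * κ)) ∧
    (K * y ^ (-κ)) ^ 3 = K ^ 3 * y ^ (-(3 * κ)) ∧
    (C * (K * y ^ (-κ)) ^ 2) ^ (3 / 2 : ℝ) = C ^ (3 / 2 : ℝ) * K ^ 3 * y ^ (-(3 * κ)) := by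
  have hyκ : 0 ≤ y ^ (-κ) := Real.rpow_nonneg hy.le _
  have e2 : (y ^ (-κ)) ^ 2 = y ^ (-(2 * κ)) := by
    rw [← Real.rpow_natCast, ← Real.rpow_mul hy.le]; congr 1; push_cast; ring
  have e3 : (y ^ (-κ)) ^ 3 = y ^ (-(3 * κ)) := by
    rw [← Real.rpow_natCast, ← Real.rpow_mul hy.le]; congr 1; push_cast; ring
  refine ⟨by rw [mul_pow, e2], by rw [mul_pow, e3], ?_⟩
  have hX : 0 ≤ K * y ^ (-κ) := mul_nonneg hK hyκ
  rw [Real.mul_rpow hC (sq_nonneg _)]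
  have e4 : ((K * y ^ (-κ)) ^ 2) ^ (3 / 2 : ℝ) = (K * y ^ (-κ)) ^ 3 := by
    rw [← Real.rpow_natCast (K * y ^ (-κ)) 2, ← Real.rpow_mul hX, ← Real.rpow_natCast (K * y ^ (-κ)) 3]
    norm_num
  rw [e4, mul_pow, e3]
  ring

/-- The majorant: `A y^{−2κ} + B y^{−3κ} ≤ (A + B)(1 + y^{−3κ})` for `A, B, κ ≥ 0`, `y > 0`. [folklore] -/
theorem majorant_le {A B κ y : ℝ} (hA : 0 ≤ A) (hB : 0 ≤ B) (hκ : 0 ≤ κ) (hy : 0 < y) :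
    A * y ^ (-(2 * κ)) + B * y ^ (-(3 * κ)) ≤ (A + B) * (1 + y ^ (-(3 * κ))) := by
  have h3 : 0 ≤ y ^ (-(3 * κ)) := Real.rpow_nonneg hy.le _
  have h2 : y ^ (-(2 * κ)) ≤ 1 + y ^ (-(3 * κ)) := by
    rcases le_or_gt 1 y with hy1 | hy1
    · have : y ^ (-(2 * κ)) ≤ 1 := Real.rpow_le_one_of_one_le_of_nonpos hy1 (by nlinarith)
      linarith
    · have : y ^ (-(2 * κ)) ≤ y ^ (-(3 * κ)) :=
        Real.rpow_le_rpow_of_exponent_ge hy hy1.le (by nlinarith)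
      linarith
  nlinarith [mul_le_mul_of_nonneg_left h2 hA]

/-- The majorant `s ↦ 1 + (−s)^{−3κ}` is interval integrable on `[a, 0]` for `3κ < 1`. [folklore] -/
theorem intervalIntegrable_one_add_rpow_neg {κ : ℝ} (hκ3 : 3 * κ < 1) (a : ℝ) :
    IntervalIntegrable (fun s : ℝ => 1 + (-s) ^ (-(3 * κ))) volume a 0 := by
  have h1 : IntervalIntegrable (fun x : ℝ => x ^ (-(3 * κ))) volume (-a) 0 :=
    intervalIntegral.intervalIntegrable_rpow' (by linarith)
  have h2 := h1.comp_sub_left 0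
  simp only [zero_sub, sub_zero, neg_neg] at h2
  exact (intervalIntegrable_const).add h2

end Real

/-! ### The slice pressures -/

section Pressure

variable {u : ℝ → (EuclideanSpace ℝ (Fin 3)) → (EuclideanSpace ℝ (Fin 3))}
  {p : ℝ → (EuclideanSpace ℝ (Fin 3)) → ℝ}

/-- **The slice pressures of a classical `L^q` solution with a rate** ((2.4b) with the
normalisation of `PressureNormalisationLq`): if `(u, p)` is a classical solution of the unforced
system (`ν = 1`) on `(−∞, 0)` with `‖u(t)‖_{L^q} ≤ K₀(−t)^{−κ}` on `(−T, 0)`, `2 < q`, then there is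
`C_q` such that for every `t ∈ (−T, 0)` some `Q ∈ L^{q/2}` satisfies `‖Q‖_{q/2} ≤ C_q ‖u(t)‖_q²`,
the weak pressure Poisson equation of `u(t)`, and `p(t) = Q + C` a.e. (apply the normalisation on
the subinterval `(−T, t/2)`, where the rate is a uniform bound). [cite: ChaeWolf2017RemovingDSS, §2 (2.4b) (arXiv p. 5); Tao2011 Lemma 4.1 (i)] -/
theorem exists_rieszPressure_slice_of_rate (hsol : IsClassicalNSSolutionOn (Iio 0) 1 0 u p)
    {q : ℝ} (hq : 2 < q) {κ K₀ T : ℝ} (hκ : 0 ≤ κ) (hK₀ : 0 ≤ K₀)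
    (hLq : ∀ t ∈ Ioo (-T) 0, MemLp (u t) (ENNReal.ofReal q) volume)
    (hrate : ∀ t ∈ Ioo (-T) 0,
      eLpNorm (u t) (ENNReal.ofReal q) volume ≤ ENNReal.ofReal (K₀ * (-t) ^ (-κ))) :
    ∃ Cq : ℝ≥0, ∀ t ∈ Ioo (-T) 0, ∃ Q : (EuclideanSpace ℝ (Fin 3)) → ℝ,
      MemLp Q (ENNReal.ofReal (q / 2)) volume ∧
      eLpNorm Q (ENNReal.ofReal (q / 2)) volume ≤
        Cq * eLpNorm (u t) (ENNReal.ofReal q) volume ^ 2 ∧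
      (∀ φ : (EuclideanSpace ℝ (Fin 3)) → ℝ, ContDiff ℝ ∞ φ → HasCompactSupport φ →
        ∫ y, Q y * (Δ φ) y = -∫ y, fderiv ℝ (fderiv ℝ φ) y (u t y) (u t y)) ∧
      ∃ C : ℝ, ∀ᵐ x ∂(volume : Measure (EuclideanSpace ℝ (Fin 3))), p t x = Q x + C := by
  have hq2 : 1 < q / 2 := by linarith
  obtain ⟨Cq, hCq⟩ := exists_rieszPressure hq2
  have e2 : ENNReal.ofReal (q / 2) * 2 = ENNReal.ofReal q := by
    rw [← ENNReal.ofReal_ofNat 2, ← ENNReal.ofReal_mul (by linarith)]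
    congr 1; ring
  -- the slice pressures everywhere on `(−T, 0)`
  have hex : ∀ s ∈ Ioo (-T) 0, ∃ Q : (EuclideanSpace ℝ (Fin 3)) → ℝ,
      MemLp Q (ENNReal.ofReal (q / 2)) volume ∧
      eLpNorm Q (ENNReal.ofReal (q / 2)) volume ≤ Cq * eLpNorm (u s) (ENNReal.ofReal q) volume ^ 2 ∧
      ∀ φ : (EuclideanSpace ℝ (Fin 3)) → ℝ, ContDiff ℝ ∞ φ → HasCompactSupport φ →
        ∫ y, Q y * (Δ φ) y = -∫ y, fderiv ℝ (fderiv ℝ φ) y (u s y) (u s y) := by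
    intro s hs
    have hu : MemLp (u s) (ENNReal.ofReal (q / 2) * 2) volume := by rw [e2]; exact hLq s hs
    obtain ⟨Q, hQ, hQb, hQeq⟩ := hCq (u s) hu
    rw [e2] at hQb
    exact ⟨Q, hQ, hQb, hQeq⟩
  choose! Qt hQt hQtb hQteq using hex
  refine ⟨Cq, fun t ht => ⟨Qt t, hQt t ht, hQtb t ht, hQteq t ht, ?_⟩⟩
  -- the subinterval `(−T, t/2)` and the uniform bound there
  have ht2 : t < t / 2 := by linarith [ht.2]
  have ht20 : t / 2 < 0 := by linarith [ht.2]
  have hsub : Ioo (-T) (t / 2) ⊆ Ioo (-T) 0 := fun s hs => ⟨hs.1, hs.2.trans ht20⟩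
  have hsol' : IsClassicalNSSolutionOn (Ioo (-T) (t / 2)) 1 0 u p :=
    hsol.mono (fun s hs => (hs.2.trans ht20 : s < 0)) (uniqueDiffOn_Ioo _ _)
  set m : ℝ := K₀ * (-(t / 2)) ^ (-κ) with hm
  have hm0 : 0 ≤ m := mul_nonneg hK₀ (Real.rpow_nonneg (by linarith) _)
  have hM : ∀ s ∈ Ioo (-T) (t / 2), eLpNorm (u s) (ENNReal.ofReal q) volume ≤ (m.toNNReal : ℝ≥0∞) := by
    intro s hs
    refine (hrate s (hsub hs)).trans ?_
    rw [ENNReal.ofReal]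
    refine ENNReal.coe_le_coe.2 (Real.toNNReal_le_toNNReal ?_)
    refine mul_le_mul_of_nonneg_left ?_ hK₀
    exact Real.rpow_le_rpow_of_nonpos (by linarith) (by linarith [hs.2]) (by linarith)
  have hP : ∀ s ∈ Ioo (-T) (t / 2), eLpNorm (Qt s) (ENNReal.ofReal (q / 2)) volume ≤
      ((Cq * m.toNNReal ^ 2 : ℝ≥0) : ℝ≥0∞) := by
    intro s hs
    calc eLpNorm (Qt s) (ENNReal.ofReal (q / 2)) volume
        ≤ Cq * eLpNorm (u s) (ENNReal.ofReal q) volume ^ 2 := hQtb s (hsub hs)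
      _ ≤ Cq * (m.toNNReal : ℝ≥0∞) ^ 2 := by gcongr; exact hM s hs
      _ = ((Cq * m.toNNReal ^ 2 : ℝ≥0) : ℝ≥0∞) := by push_cast; ring
  exact pressure_ae_eq_add_const (le_of_lt one_pos) hsol' hq hM
    (fun s hs => hQt s (hsub hs)) hP (fun s hs => hQteq s (hsub hs)) ⟨ht.1, ht2⟩

end Pressure

/-! ### The uniform local energy bound up to the top -/

section Energy

variable {u : ℝ → (EuclideanSpace ℝ (Fin 3)) → (EuclideanSpace ℝ (Fin 3))}
  {p : ℝ → (EuclideanSpace ℝ (Fin 3)) → ℝ}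

/-- **The local energy identity integrated from `t₀` gives a uniform bound up to `t = 0`**
(Chae–Wolf 2017, Step 2, range without absorption). For a classical solution of the unforced
system (`ν = 1`) on `(−∞, 0)` with the rate `‖u(t)‖_{L^q} ≤ K₀(−t)^{−κ}` on `(−T, 0)`, `3 ≤ q`,
`3κ < 1`, a cut-off `φ ∈ C_c^∞` supported in `B̄(x₀, R)`, and `−T < t₀ < 0`:
`∫ φ|u(t)|² + 2 ∫_{t₀}^t ∫ |∇u|²φ ≤ Λ` for all `t ∈ [t₀, 0)`, with `Λ < ∞` independent of `t`. [cite: ChaeWolf2017RemovingDSS, §2 Step 2, (2.4f)–(2.4c) (arXiv p. 5–6)] -/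
theorem exists_uniform_energy_bound (hsol : IsClassicalNSSolutionOn (Iio 0) 1 0 u p)
    {q : ℝ} (hq : 3 ≤ q) {κ K₀ T : ℝ} (hκ : 0 ≤ κ) (hκ3 : 3 * κ < 1) (hK₀ : 0 ≤ K₀)
    (hLq : ∀ t ∈ Ioo (-T) 0, MemLp (u t) (ENNReal.ofReal q) volume)
    (hrate : ∀ t ∈ Ioo (-T) 0,
      eLpNorm (u t) (ENNReal.ofReal q) volume ≤ ENNReal.ofReal (K₀ * (-t) ^ (-κ)))
    {φ : (EuclideanSpace ℝ (Fin 3)) → ℝ} {x₀ : (EuclideanSpace ℝ (Fin 3))} {R : ℝ}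
    (hφ : ContDiff ℝ ∞ φ) (hφsupp : tsupport φ ⊆ closedBall x₀ R)
    {t₀ : ℝ} (ht₀ : -T < t₀) (ht₀0 : t₀ < 0) :
    ∃ Λ : ℝ, ∀ t ∈ Ico t₀ 0,
      (∫ x, φ x * ‖u t x‖ ^ 2) +
        2 * ∫ s in t₀..t, ∫ x, frobeniusNormSq (fderiv ℝ (u s) x) * φ x ≤ Λ := by
  have hS : IsOpen (Iio (0 : ℝ)) := isOpen_Iio
  have hq2 : (2 : ℝ) < q := by linarith
  -- regularity of the cut-off and bounds of its derivatives
  have hφc : HasCompactSupport φ :=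
    IsCompact.of_isClosed_subset (isCompact_closedBall x₀ R) (isClosed_tsupport _) hφsupp
  have hφ1 : ContDiff ℝ 1 φ := hφ.of_le (by norm_cast)
  have hφ2 : ContDiff ℝ 2 φ := hφ.of_le (by norm_cast)
  have hΔc : Continuous (Δ φ) := FluidPDE.continuous_laplacian hφ2
  have hΔs : HasCompactSupport (Δ φ) := hφc.mono' fun x hx => by
    contrapose! hx
    simp [FluidPDE.laplacian_eq_zero_of_notMem_tsupport hx]
  obtain ⟨CΔ, hCΔ⟩ := hΔc.bounded_above_of_compact_support hΔs
  obtain ⟨CD, hCD⟩ := (hφ1.continuous_fderiv one_ne_zero).bounded_above_of_compact_support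
    (hφc.fderiv (𝕜 := ℝ))
  have hCΔ0 : 0 ≤ CΔ := (norm_nonneg _).trans (hCΔ 0)
  have hCD0 : 0 ≤ CD := (norm_nonneg _).trans (hCD 0)
  have hCΔ' : ∀ x, |(Δ φ) x| ≤ CΔ := fun x => by rw [← Real.norm_eq_abs]; exact hCΔ x
  -- the slice pressures
  obtain ⟨Cq, hQex⟩ := exists_rieszPressure_slice_of_rate hsol hq2 hκ hK₀ hLq hrate
  choose! Qt hQt hQtb hQteq Ct hCt using hQex
  -- the constants
  set V : ℝ := (volume : Measure (EuclideanSpace ℝ (Fin 3))).real (closedBall x₀ R) with hV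
  have hV0 : 0 ≤ V := measureReal_nonneg
  set A : ℝ := CΔ * V ^ (1 - 2 / q) * K₀ ^ 2 with hA
  set B : ℝ := CD * V ^ (1 - 3 / q) * K₀ ^ 3 +
    2 * CD * (2 / 3 * V ^ (1 - 3 / q) * (Cq : ℝ) ^ (3 / 2 : ℝ) * K₀ ^ 3 + 1 / 3 * V ^ (1 - 3 / q) * K₀ ^ 3)
    with hB
  have hA0 : 0 ≤ A := by positivity
  have hB0 : 0 ≤ B := by positivity
  set Λ₀ : ℝ := A + B with hΛ₀
  have hΛ₀0 : 0 ≤ Λ₀ := add_nonneg hA0 hB0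
  -- the flux and its pointwise bound on `(−T, 0)`
  set Flux : ℝ → ℝ := fun s => ∫ x, ((1 : ℝ) * ((Δ φ) x * ‖u s x‖ ^ 2) +
    fderiv ℝ φ x (u s x) * ‖u s x‖ ^ 2 + 2 * (p s x * fderiv ℝ φ x (u s x))) with hFlux
  have hbound : ∀ s ∈ Ioo (-T) 0, ‖Flux s‖ ≤ Λ₀ * (1 + (-s) ^ (-(3 * κ))) := by
    intro s hs
    have hs0 : 0 < -s := by linarith [hs.2]
    set M : ℝ≥0 := (K₀ * (-s) ^ (-κ)).toNNReal with hM
    have hMval : (M : ℝ) = K₀ * (-s) ^ (-κ) :=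
      Real.coe_toNNReal _ (mul_nonneg hK₀ (Real.rpow_nonneg hs0.le _))
    have hvM : eLpNorm (u s) (ENNReal.ofReal q) volume ≤ M := hrate s hs
    set P : ℝ≥0 := Cq * M ^ 2 with hP
    have hQP : eLpNorm (Qt s) (ENNReal.ofReal (q / 2)) volume ≤ P := by
      calc eLpNorm (Qt s) (ENNReal.ofReal (q / 2)) volume
          ≤ Cq * eLpNorm (u s) (ENNReal.ofReal q) volume ^ 2 := hQtb s hs
        _ ≤ Cq * (M : ℝ≥0∞) ^ 2 := by gcongr
        _ = (P : ℝ≥0∞) := by rw [hP]; push_cast; ring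
    have hs' : s ∈ Iio (0 : ℝ) := hs.2
    have key := abs_flux_cutoff_le hφ hφsupp hCΔ' hCD hCΔ0 hCD0
      ((hsol.contDiff_velocity hs').of_le (by norm_cast)) (hsol.divFree s hs') hq hvM
      (hsol.contDiff_pressure hs').continuous (hQt s hs) hQP (hCt s hs) (le_of_lt one_pos)
    rw [Real.norm_eq_abs]
    refine key.trans ?_
    obtain ⟨i2, i3, i32⟩ := rate_pow_identities (κ := κ) hK₀ Cq.coe_nonneg hs0
    have hPval : (P : ℝ) = Cq * (K₀ * (-s) ^ (-κ)) ^ 2 := by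
      rw [hP, NNReal.coe_mul, NNReal.coe_pow, hMval]
    rw [hMval, hPval, i32, i2, i3]
    have e : 1 * CΔ * (V ^ (1 - 2 / q) * (K₀ ^ 2 * (-s) ^ (-(2 * κ)))) +
        CD * (V ^ (1 - 3 / q) * (K₀ ^ 3 * (-s) ^ (-(3 * κ)))) +
        2 * CD * (2 / 3 * (V ^ (1 - 3 / q) * ((Cq : ℝ) ^ (3 / 2 : ℝ) * K₀ ^ 3 * (-s) ^ (-(3 * κ)))) +
          1 / 3 * (V ^ (1 - 3 / q) * (K₀ ^ 3 * (-s) ^ (-(3 * κ))))) =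
        A * (-s) ^ (-(2 * κ)) + B * (-s) ^ (-(3 * κ)) := by
      rw [hA, hB]; ring
    rw [e]
    exact majorant_le hA0 hB0 hκ hs0
  -- continuity of the flux and of the dissipation on `(−∞, 0)`
  have cF : ContinuousOn Flux (Iio 0) := hsol.continuousOn_integral_flux_cutoff hφ hφc
  have cG : ContinuousOn (fun s => ∫ x, frobeniusNormSq (fderiv ℝ (u s) x) * φ x) (Iio 0) :=
    hsol.continuousOn_integral_dissipation_cutoff hS hφ.continuous hφc
  -- the majorant integral
  have imaj : IntervalIntegrable (fun s : ℝ => Λ₀ * (1 + (-s) ^ (-(3 * κ)))) volume t₀ 0 :=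
    (intervalIntegrable_one_add_rpow_neg hκ3 t₀).const_mul Λ₀
  set Imaj : ℝ := ∫ s in t₀..0, Λ₀ * (1 + (-s) ^ (-(3 * κ))) with hImaj
  refine ⟨(∫ x, φ x * ‖u t₀ x‖ ^ 2) + Imaj, fun t ht => ?_⟩
  have ht0 : t < 0 := ht.2
  have hI : Icc t₀ t ⊆ Iio 0 := fun s hs => lt_of_le_of_lt hs.2 ht0
  have hI' : uIcc t₀ t ⊆ Iio 0 := by rwa [uIcc_of_le ht.1]
  have hIT : Ioo t₀ t ⊆ Ioo (-T) 0 := fun s hs => ⟨ht₀.trans hs.1, hs.2.trans ht0⟩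
  -- the identity on `[t₀, t]`
  have hid := hsol.local_energy_identity_cutoff hS hφ hφc ht.1 hI
  -- bound of the flux integral
  have iF : IntervalIntegrable Flux volume t₀ t := (cF.mono hI').intervalIntegrable
  have imaj' : IntervalIntegrable (fun s : ℝ => Λ₀ * (1 + (-s) ^ (-(3 * κ)))) volume t₀ t := by
    refine imaj.mono_set ?_
    rw [uIcc_of_le ht.1, uIcc_of_le ht₀0.le]
    exact Icc_subset_Icc le_rfl ht0.le
  have hF1 : ∫ s in t₀..t, Flux s ≤ ∫ s in t₀..t, Λ₀ * (1 + (-s) ^ (-(3 * κ))) := by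
    calc ∫ s in t₀..t, Flux s ≤ ‖∫ s in t₀..t, Flux s‖ := Real.le_norm_self _
      _ ≤ ∫ s in t₀..t, ‖Flux s‖ := intervalIntegral.norm_integral_le_integral_norm ht.1
      _ ≤ ∫ s in t₀..t, Λ₀ * (1 + (-s) ^ (-(3 * κ))) :=
          intervalIntegral.integral_mono_on_of_le_Ioo ht.1 iF.norm imaj' fun s hs => hbound s (hIT hs)
  have hF2 : ∫ s in t₀..t, Λ₀ * (1 + (-s) ^ (-(3 * κ))) ≤ Imaj := by
    refine intervalIntegral.integral_mono_interval le_rfl ht.1 ht0.le ?_ imaj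
    refine (ae_restrict_iff' measurableSet_Ioc).2 (Eventually.of_forall fun s hs => ?_)
    have : 0 ≤ (-s) ^ (-(3 * κ)) := Real.rpow_nonneg (by linarith [hs.2]) _
    positivity
  simp only [mul_one] at hid
  linarith

/-- **Chae–Wolf 2017, (2.4c), in the range without absorption**: for a classical solution of the
unforced Navier–Stokes system (`ν = 1`) on `ℝ³ × (−∞, 0)` with `u(t) ∈ L^q`, `3 ≤ q`, and the
rate `‖u(t)‖_{L^q} ≤ K₀(−t)^{−κ}` on `(−T, 0)` with `3κ < 1`, every backward cylinder
`Q_ρ(0, x₀)`, `ρ² < T`, carries the local energy classes **up to the top time**: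
`sup_{−ρ² < t < 0} ∫_{B(x₀,ρ)} |u(t)|² < ∞` and `∫∫_{Q_ρ(0,x₀)} |∇u|² < ∞`. [cite: ChaeWolf2017RemovingDSS, §2 Step 2, (2.4c) (arXiv p. 6)] -/
theorem _root_.Literature.Analysis.FluidPDE.IsClassicalNSSolutionOn.exists_energy_classes_of_rate
    (hsol : IsClassicalNSSolutionOn (Iio 0) 1 0 u p)
    {q : ℝ} (hq : 3 ≤ q) {κ K₀ T : ℝ} (hκ : 0 ≤ κ) (hκ3 : 3 * κ < 1) (hK₀ : 0 ≤ K₀)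
    (hLq : ∀ t ∈ Ioo (-T) 0, MemLp (u t) (ENNReal.ofReal q) volume)
    (hrate : ∀ t ∈ Ioo (-T) 0,
      eLpNorm (u t) (ENNReal.ofReal q) volume ≤ ENNReal.ofReal (K₀ * (-t) ^ (-κ)))
    (x₀ : (EuclideanSpace ℝ (Fin 3))) {ρ : ℝ} (hρ : 0 < ρ) (hρT : ρ ^ 2 < T) :
    (∃ C : ℝ≥0, ∀ t ∈ Ioo (-ρ ^ 2) 0, ∫⁻ x in ball x₀ ρ, ‖u t x‖ₑ ^ 2 ≤ C) ∧
    ∫⁻ w in parabolicCylinder ρ ((0 : ℝ), x₀),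
      ENNReal.ofReal (frobeniusNormSq (fderiv ℝ (u w.1) w.2)) < ⊤ := by
  have hS : IsOpen (Iio (0 : ℝ)) := isOpen_Iio
  -- the cut-off
  let φ : ContDiffBump x₀ := ⟨ρ, 2 * ρ, hρ, by linarith⟩
  have hφs : ContDiff ℝ ∞ φ := φ.contDiff
  have hφc : HasCompactSupport φ := φ.hasCompactSupport
  have hφsupp : tsupport φ ⊆ closedBall x₀ (2 * ρ) := by rw [φ.tsupport_eq]
  have hφ1 : ∀ x ∈ ball x₀ ρ, φ x = 1 := fun x hx =>
    φ.one_of_mem_closedBall (ball_subset_closedBall hx)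
  -- the initial time `t₀`
  set t₀ : ℝ := -((T + ρ ^ 2) / 2) with ht₀
  have ht₀T : -T < t₀ := by rw [ht₀]; linarith
  have ht₀ρ : t₀ < -ρ ^ 2 := by rw [ht₀]; linarith
  have ht₀0 : t₀ < 0 := by rw [ht₀]; nlinarith
  obtain ⟨Λ, hΛ⟩ := exists_uniform_energy_bound hsol hq hκ hκ3 hK₀ hLq hrate hφs hφsupp ht₀T ht₀0
  -- names for energy and dissipation
  set e : ℝ → ℝ := fun t => ∫ x, φ x * ‖u t x‖ ^ 2 with he
  set G : ℝ → ℝ := fun s => ∫ x, frobeniusNormSq (fderiv ℝ (u s) x) * φ x with hG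
  have hGnn : ∀ s, 0 ≤ G s := fun s =>
    integral_nonneg fun x => mul_nonneg (frobeniusNormSq_nonneg _) φ.nonneg
  have henn : ∀ t, 0 ≤ e t := fun t => integral_nonneg fun x => mul_nonneg φ.nonneg (sq_nonneg _)
  have cG : ContinuousOn G (Iio 0) :=
    hsol.continuousOn_integral_dissipation_cutoff hS hφs.continuous hφc
  have hIG : ∀ t ∈ Ico t₀ 0, 0 ≤ ∫ s in t₀..t, G s := fun t ht =>
    intervalIntegral.integral_nonneg ht.1 fun s _ => hGnn s
  have he_le : ∀ t ∈ Ico t₀ 0, e t ≤ Λ := fun t ht => by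
    have := hΛ t ht; have := hIG t ht; linarith
  have hG_le : ∀ t ∈ Ico t₀ 0, ∫ s in t₀..t, G s ≤ Λ / 2 := fun t ht => by
    have := hΛ t ht; have := henn t; linarith
  have hΛ0 : 0 ≤ Λ := (henn t₀).trans (he_le t₀ ⟨le_rfl, ht₀0⟩)
  refine ⟨⟨Λ.toNNReal, fun t ht => ?_⟩, ?_⟩
  · -- ## the `L^∞_t L²_x` class
    have ht' : t ∈ Ico t₀ 0 := ⟨(ht₀ρ.trans ht.1).le, ht.2⟩
    have huc : Continuous (u t) := (hsol.contDiff_velocity (ht.2 : t < 0)).continuous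
    have hball : IntegrableOn (fun x => ‖u t x‖ ^ 2) (ball x₀ ρ) volume :=
      ((huc.norm.pow 2).continuousOn.integrableOn_compact (isCompact_closedBall x₀ ρ)).mono_set
        ball_subset_closedBall
    have hφu : Integrable (fun x => φ x * ‖u t x‖ ^ 2) volume :=
      (φ.continuous.mul (huc.norm.pow 2)).integrable_of_hasCompactSupport hφc.mul_right
    have h1 : ∫ x in ball x₀ ρ, ‖u t x‖ ^ 2 ≤ e t := by
      rw [he, ← integral_indicator measurableSet_ball]
      refine integral_mono (hball.integrable_indicator measurableSet_ball) hφu fun x => ?_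
      by_cases hx : x ∈ ball x₀ ρ
      · rw [indicator_of_mem hx, hφ1 x hx, one_mul]
      · rw [indicator_of_notMem hx]; exact mul_nonneg φ.nonneg (sq_nonneg _)
    have h2 : ∫⁻ x in ball x₀ ρ, ‖u t x‖ₑ ^ 2 = ENNReal.ofReal (∫ x in ball x₀ ρ, ‖u t x‖ ^ 2) := by
      rw [ofReal_integral_eq_lintegral_ofReal hball (ae_of_all _ fun x => sq_nonneg _)]
      refine lintegral_congr fun x => ?_
      rw [← ofReal_norm, ← ENNReal.ofReal_pow (norm_nonneg _)]
    rw [h2, ENNReal.ofReal]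
    exact ENNReal.coe_le_coe.2 (Real.toNNReal_le_toNNReal (h1.trans (he_le t ht')))
  · -- ## the dissipation class
    set F : ℝ × (EuclideanSpace ℝ (Fin 3)) → ℝ≥0∞ := fun w =>
      ENNReal.ofReal (frobeniusNormSq (fderiv ℝ (u w.1) w.2)) with hF
    -- continuity of `F` below `t = 0`
    have hu1 : ContDiffOn ℝ 1 (uncurry u) (Iio 0 ×ˢ univ) := hsol.smooth_velocity.of_le (by norm_cast)
    have cDu : ContinuousOn (fun z : ℝ × (EuclideanSpace ℝ (Fin 3)) => fderiv ℝ (u z.1) z.2)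
        (Iio 0 ×ˢ univ) := continuousOn_fderiv_slice_of_contDiffOn hu1 hS.uniqueDiffOn
    have cF : ContinuousOn F (Iio 0 ×ˢ univ) :=
      ENNReal.continuous_ofReal.comp_continuousOn (continuous_frobeniusNormSq_clm.comp_continuousOn cDu)
    -- the bound on truncated cylinders
    have hcyl : ∀ t ∈ Ioo (-ρ ^ 2) 0,
        ∫⁻ w in Ioo (0 - ρ ^ 2) t ×ˢ ball x₀ ρ, F w ≤ ENNReal.ofReal (Λ / 2) := by
      intro t ht
      have ht' : t ∈ Ico t₀ 0 := ⟨(ht₀ρ.trans ht.1).le, ht.2⟩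
      have hsub : Ioo (0 - ρ ^ 2) t ×ˢ ball x₀ ρ ⊆ Iio (0 : ℝ) ×ˢ (univ : Set (EuclideanSpace ℝ (Fin 3))) :=
        prod_mono (fun s hs => (hs.2.trans ht.2 : s < 0)) (subset_univ _)
      have hFm : AEMeasurable F ((volume.restrict (Ioo (0 - ρ ^ 2) t)).prod
          (volume.restrict (ball x₀ ρ))) := by
        rw [Measure.prod_restrict]
        exact (cF.mono hsub).aemeasurable (measurableSet_Ioo.prod measurableSet_ball)
      have hvol : (volume : Measure (ℝ × (EuclideanSpace ℝ (Fin 3)))) =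
          (volume : Measure ℝ).prod (volume : Measure (EuclideanSpace ℝ (Fin 3))) := rfl
      rw [hvol, ← Measure.prod_restrict, lintegral_prod _ hFm]
      -- inner integral
      have hinner : ∀ s ∈ Ioo (0 - ρ ^ 2) t, ∫⁻ x in ball x₀ ρ, F (s, x) ≤ ENNReal.ofReal (G s) := by
        intro s hs
        have hs0 : s < 0 := hs.2.trans ht.2
        have cfs : Continuous fun x => frobeniusNormSq (fderiv ℝ (u s) x) :=
          continuous_frobeniusNormSq_clm.comp
            (((hsol.contDiff_velocity hs0).of_le
              (by norm_cast : (1 : WithTop ℕ∞) ≤ ((⊤ : ℕ∞) : WithTop ℕ∞))).continuous_fderiv one_ne_zero)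
        have hint : Integrable (fun x => frobeniusNormSq (fderiv ℝ (u s) x) * φ x) volume :=
          (cfs.mul φ.continuous).integrable_of_hasCompactSupport hφc.mul_left
        calc ∫⁻ x in ball x₀ ρ, F (s, x)
            = ∫⁻ x in ball x₀ ρ, ENNReal.ofReal (frobeniusNormSq (fderiv ℝ (u s) x) * φ x) := by
              refine setLIntegral_congr_fun measurableSet_ball fun x hx => ?_
              simp only [hF, hφ1 x hx, mul_one]
          _ ≤ ∫⁻ x, ENNReal.ofReal (frobeniusNormSq (fderiv ℝ (u s) x) * φ x) :=
              lintegral_mono' Measure.restrict_le_self le_rfl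
          _ = ENNReal.ofReal (G s) := by
              rw [hG, ofReal_integral_eq_lintegral_ofReal hint]
              exact ae_of_all _ fun x => mul_nonneg (frobeniusNormSq_nonneg _) φ.nonneg
      -- outer integral
      have hle : -ρ ^ 2 ≤ t := ht.1.le
      have hIcc : Icc (0 - ρ ^ 2) t ⊆ Iio 0 := fun s hs => lt_of_le_of_lt hs.2 ht.2
      have iG : IntegrableOn G (Ioo (0 - ρ ^ 2) t) volume :=
        ((cG.mono hIcc).integrableOn_compact isCompact_Icc).mono_set Ioo_subset_Icc_self
      calc ∫⁻ s in Ioo (0 - ρ ^ 2) t, ∫⁻ x in ball x₀ ρ, F (s, x)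
          ≤ ∫⁻ s in Ioo (0 - ρ ^ 2) t, ENNReal.ofReal (G s) :=
            setLIntegral_mono' measurableSet_Ioo fun s hs => hinner s hs
        _ = ENNReal.ofReal (∫ s in Ioo (0 - ρ ^ 2) t, G s) :=
            (ofReal_integral_eq_lintegral_ofReal iG (ae_of_all _ fun s => hGnn s)).symm
        _ = ENNReal.ofReal (∫ s in (0 - ρ ^ 2)..t, G s) := by
            rw [intervalIntegral.integral_of_le (by linarith), integral_Ioc_eq_integral_Ioo]
        _ ≤ ENNReal.ofReal (∫ s in t₀..t, G s) := by
            refine ENNReal.ofReal_le_ofReal ?_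
            refine intervalIntegral.integral_mono_interval (by linarith) (by linarith) le_rfl ?_ ?_
            · exact ae_of_all _ fun s => hGnn s
            · refine ((cG.mono ?_).intervalIntegrable)
              rw [uIcc_of_le ht'.1]
              exact fun s hs => lt_of_le_of_lt hs.2 ht.2
        _ ≤ ENNReal.ofReal (Λ / 2) := ENNReal.ofReal_le_ofReal (hG_le t ht')
    -- exhaustion of the cylinder
    set tn : ℕ → ℝ := fun n => -(ρ ^ 2 / ((n : ℝ) + 2)) with htn
    have htn_mem : ∀ n, tn n ∈ Ioo (-ρ ^ 2) 0 := fun n => by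
      have h2 : (0 : ℝ) < (n : ℝ) + 2 := by positivity
      have hρ2 : 0 < ρ ^ 2 := by positivity
      refine ⟨?_, ?_⟩
      · rw [htn]
        have : ρ ^ 2 / ((n : ℝ) + 2) < ρ ^ 2 := by
          rw [div_lt_iff₀ h2]; nlinarith
        linarith
      · rw [htn]; exact neg_neg_of_pos (div_pos hρ2 h2)
    have hmono : Monotone fun n => Ioo (0 - ρ ^ 2) (tn n) ×ˢ ball x₀ ρ := by
      intro m n hmn
      refine prod_mono (Ioo_subset_Ioo le_rfl ?_) subset_rfl
      rw [htn]
      have h2 : (0 : ℝ) < (m : ℝ) + 2 := by positivity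
      have : ρ ^ 2 / ((n : ℝ) + 2) ≤ ρ ^ 2 / ((m : ℝ) + 2) :=
        div_le_div_of_nonneg_left (by positivity) h2 (by exact_mod_cast Nat.add_le_add_right hmn 2)
      linarith
    have hunion : (⋃ n, Ioo (0 - ρ ^ 2) (tn n) ×ˢ ball x₀ ρ) = parabolicCylinder ρ ((0 : ℝ), x₀) := by
      rw [parabolicCylinder, ← iUnion_prod_const]
      congr 1
      ext s
      simp only [mem_iUnion, mem_Ioo]
      constructor
      · rintro ⟨n, h1, h2⟩; exact ⟨h1, h2.trans (htn_mem n).2⟩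
      · rintro ⟨h1, h2⟩
        have hs : 0 < -s := by linarith
        obtain ⟨n, hn⟩ := exists_nat_gt (ρ ^ 2 / -s)
        refine ⟨n, h1, ?_⟩
        rw [htn]
        have h2' : (0 : ℝ) < (n : ℝ) + 2 := by positivity
        have : ρ ^ 2 / ((n : ℝ) + 2) < -s := by
          rw [div_lt_iff₀ h2']
          rw [div_lt_iff₀ hs] at hn
          nlinarith
        linarith
    rw [← hunion, setLIntegral_iUnion_of_directed F hmono.directed_le]
    refine lt_of_le_of_lt (iSup_le fun n => hcyl (tn n) (htn_mem n)) ENNReal.ofReal_lt_top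

end Energy

end ChaeWolfEnergy

end Literature.Analysis.FluidPDE

end
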